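import Summits.HubbardSuperconductivity.HubbardSuperconductivity.Theorems.AnisotropyChordTransferFibre3Hole2AllL
import Summits.HubbardSuperconductivity.HubbardSuperconductivity.Theorems.AnisotropyChordTransferFibre3CruxWindow

/-!
# Route `AnisotropyChord` / H0 rotor rung: the WINDOWED GM₃ assembly without the HOLE₂ hypothesis (`L ≥ 31`)

p1 g24's `gm3_of_hole2_window` (`…Fibre3CruxWindow`: HOLE₂(.75) + the three β-free cruxes and the regime clause asked only on the
a-priori window `0 < λ₂ ≤ .0513·θ²`) with its HOLE₂(.75) hypothesis DISCHARGED by `Hole2.twoHoleGap_threeQuarter` (`…Fibre3Hole2AllL`,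
every `L ≥ 9`): `gm3_allL_window`.  This is the entry point for the Level-2 / FIN producers of the crux constants `(c, a, b)`: at
`L ≥ 31`, GM₃ in the fibre follows from the three windowed crux inequalities and the windowed regime clause alone.
Prover seat `hubbard-h0-rotor-p3` g4; helper for stmt-HubbardSuperconductivity-19089 (`--supports`, helper class).
WHAT THIS IS NOT: nothing here proves superconductivity in the Hubbard model (rotor TARGET as worded stays FALSE, g15 verdict); it
removes ONE hypothesis of ONE conditional reduction (rung 19089); the windowed cruxes, `mHole ≥ 0` and the side condition remain
hypotheses. Tree imports only; no sorry, no axioms beyond the standard three.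
-/

set_option linter.dupNamespace false
set_option autoImplicit false

noncomputable section

namespace Summit.HubbardSuperconductivity.HubbardSuperconductivity.Theorems.AnisotropyChord.Transfer.Fibre3

/-- ★ **GM₃ from the three WINDOWED β-free cruxes and the windowed regime clause alone** (`L ≥ 31`, `0 < Δ < 1`): p1's
`gm3_of_hole2_window` with HOLE₂(.75) supplied by `Hole2.twoHoleGap_threeQuarter`. [folklore] -/
theorem gm3_allL_window (L : ℕ) [NeZero L] (hL : 31 ≤ L) {Δ : ℝ} (hΔ0 : 0 < Δ) (hΔ1 : Δ < 1) (c a b : ℝ)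
    (hreg : ∀ lam2 : ℝ, ∀ f : Tor L → ℝ, IsGroundTwoMagnon L Δ lam2 f →
      0 < lam2 → lam2 ≤ 0.0513 * (2 * Real.pi / L) ^ 2 →
        0 ≤ mHole L Δ f ∧ facMI L Δ f * etaEff L lam2 * (a + b / (2 + Real.cos (2 * Real.pi / L))) < c)
    (hKT1 : ∀ lam2 : ℝ, ∀ f : Tor L → ℝ, IsGroundTwoMagnon L Δ lam2 f →
      0 < lam2 → lam2 ≤ 0.0513 * (2 * Real.pi / L) ^ 2 → c * Uunit L Δ f ≤ trialGapN1 L Δ f)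
    (hKT2a : ∀ lam2 : ℝ, ∀ f : Tor L → ℝ, IsGroundTwoMagnon L Δ lam2 f →
      0 < lam2 → lam2 ≤ 0.0513 * (2 * Real.pi / L) ^ 2 → lowGForm L Δ f ≤ a * etaEff L lam2 * Uunit L Δ f)
    (hKT2b : ∀ lam2 : ℝ, ∀ f : Tor L → ℝ, IsGroundTwoMagnon L Δ lam2 f →
      0 < lam2 → lam2 ≤ 0.0513 * (2 * Real.pi / L) ^ 2 →
        (ip L (resid L Δ f) (resid L Δ f)).re - polePart L Δ f - lowNormPart L Δ f
          ≤ b * etaEff L lam2 * (2 * eps1 L - Tplus L Δ f) * Uunit L Δ f) :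
    GM3Fibre L Δ :=
  gm3_of_hole2_window L hL hΔ0 hΔ1 c a b (Hole2.twoHoleGap_threeQuarter L (by omega)) hreg hKT1 hKT2a hKT2b

end Summit.HubbardSuperconductivity.HubbardSuperconductivity.Theorems.AnisotropyChord.Transfer.Fibre3

end
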